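import Summits.BirchSwinnertonDyer.Rank1Residual.X11b.BDPRouteOpenInputDescent
import Summits.BirchSwinnertonDyer.Rank1Residual.X11b.BDPRouteOpenInputIntFrame
import HarnessLib

/-!
# Route `ErratumRoadFive`, crux `OpenInputNotRam` (item stmt-BirchSwinnertonDyer-19282): the registered
# DECIDING stub `stub_imcDivNotRam` (H3: `Ch_Λ(X_ac^∅)·R₀⟦T⟧ ⊆ (L)` for EVERY `R₀`-frame, at ¬(ram)
# pairs and strict-Heegner data) IS — by name, in the kernel — the cell's canonical typed open statement
# (2.4)∀ ∕ (2.4)∃♭ restricted to the ¬(ram) pairs; and why the «SU14 three-variable» road cannot feed it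

Cell `bsd-stepL`, PART 1b seat `bsd-stepL-nram1` (prover; ACCEL-LIST row (4): «Skinner 2016
multiplicative-reduction converse road: SU14 three-variable divisibility specialised at `p ∥ N`, no
(ram) auxiliary prime»); `--supports stmt-BirchSwinnertonDyer-19282 --as helper`. HONEST FRAMING:
nothing here proves the stub, the crux, STEP L or BSD; THEOREMS ONLY (no definition, no named fact, no
`sorry`); every open shape below (`P2.IMCDivAllUnrFramesOnTree`, `P2.IMCDivSomeFrameOnTree` — both
`@[conjecture]`-tagged in the tree) enters as a HYPOTHESIS; nothing is booked; closes nothing (T7).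

## What this file proves

The registered skeleton of crux 19282 (`Cruxes/OpenInputNotRam/Lines/birth.lean`, sha16
`b078920a0adb81b4`, planner g25) composes four stubs; the deciding one is

  `stub_imcDivNotRam : ∀ W p N K Dt H ι P, ¬ Ram W p → ClassX11b W p → 5 ≤ p → Surj W p → … →
     ∀ κ γ 𝔭 (p ∈ 𝔭, e = f = 1) (f newform of W) (ι' : ℚ̄_p ≃ ℂ inducing 𝔭) (Ω_K ≠ 0, Ω_p ∈ R₀ˣ,
     L ∈ R₀⟦T⟧ with IsBDPLFunction ι' 𝔭 κ γ f Ω_K Ω_p L), Ch_Λ(X_ac^∅(E_K))·R₀⟦T⟧ ⊆ (L)`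

— the erratum-currency divisibility [Castella2018Erratum (2.4)] for EVERY `R₀`-frame. Sub-cell
multr1-p2 (gens 25–29) typed the SAME mathematical content as the per-pair shapes
`P2.IMCDivAllUnrFramesOnTree W p` ((2.4) for every `R₀`-frame, datum `(ι', w₀, P', e)`,
`𝔭 := 𝔭_{ι'}`, `f := f_{Dt}`) and `P2.IMCDivSomeFrameOnTree W p` ((2.4)∃♭, THE open statement of
route p2), and PROVED (2.4)∃♭ ⟹ (2.4)∀ on every pair (`P2.imcDivAllUnrFramesOnTree_of_imcDivSomeFrame`:
ideal rigidity across periods + descent `R₀⟦T⟧ → 𝓞_{ℂ_p}⟦T⟧`). This file identifies the two by name: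

* §1 `stub_imcDivNotRam_of_imcDivAllUnrFrames` — `(∀ W p, ¬ Ram W p → P2.IMCDivAllUnrFramesOnTree W p)`
  ⟹ the stub's signature VERBATIM (with the skeleton-local abbreviation `InducesPrimeAt p ι' 𝔭`
  written out as its body `∀ (w : InfinitePlace K) (k : 𝓞 K), k ∈ 𝔭 ↔ ‖ι'⁻¹(w.embedding k)‖ < 1`).
  Plumbing: the stub's `𝔭` IS `𝔭_{ι'}` (`eq_primeOfEmbeddingDatum_of_forall_mem_iff`), its `f` IS
  `f_{Dt}` (`IsNewformOf.unique`), the datum `(w₀, P', e)` is `(w₀, τ_* P, embAt)` with `τ ∈ Gal(K/ℚ)`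
  matching the stub's complex embedding `ι` to `w₀.embedding` (multr1-p2's gen-24 construction).
* §1 `stub_imcDivNotRam_of_imcDivSomeFrame` — hence `(∀ W p, ¬ Ram W p → P2.IMCDivSomeFrameOnTree W p)`
  ⟹ the stub: **the deciding stub of 19282 follows from the cell's value-free residual (2.4)∃♭|¬ram**
  (the `hOffD` binder of bdp g12's D5 kernel theorem `KernelFromPrint.openInputIMCBody_…`, p446030) —
  with NO further input (no print, no fact).
* §2 `imcDivAllUnrFramesOnTree_of_stub_imcDivNotRam` — conversely the stub ⟹ `(∀ W p, ¬ Ram W p →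
  P2.IMCDivAllUnrFramesOnTree W p)` (pure plumbing: `𝔭_{ι'}` has degree one because `p ∣ N_E` splits in
  a strict-Heegner `K`); `stub_imcDivNotRam_iff_imcDivAllUnrFrames` — **the registered stub and
  (2.4)∀|¬ram are EQUIVALENT in the kernel**, so the skeleton's H3 is neither weaker nor stronger than
  the cell's canonical open statement on these pairs.

## Why the seat's road (row (4)) does not feed H3 on these data — recorded, not typed (memo
`HOME/nram1/ROW4-MEMO.md`): (O1) Skinner–Urban 2014 Thm. 3.29 ∕ Skinner 2016 Thm. A (iii) REQUIRE the
(ram) prime — verbatim the tree's `Rank1Residual.Ram W p`, negated by the stub's first binder; (O2) every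
ℚ-rational Eisenstein-congruence engine in print (SU14 on U(2,2); Wan 2020 Thm. 1.1 ∕ CLW22 ∕ Fouquet–Wan
Thm. 4.41 ∕ the erratum's Thm. 1.1 (iii) on U(3,1)) needs a level prime `q ∥ N` NON-SPLIT in `K`
(a definite quaternion datum over ℚ), while the stub's `K` satisfies `SatisfiesHeegnerHypothesis N K`
(EVERY `ℓ ∣ N` split): parity, not residual ramification, is the obstruction; the one printed parity
evasion is even-degree base change ([BurungaleCastellaSkinner2025] via [Wan15], `n⁻ = ∅` allowed for
`[F:ℚ] = 2`), whose `p ∥ N` transposition has exactly one sourceless brick ((R4♯), PROOF-BDP §30).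
Hence the honest kernel content of row (4) for 19282 is this identification: ANY road that lands
(2.4)∃♭ on the ¬(ram) pairs closes `stub_imcDivNotRam`, and conversely.

References: [Castella2018Erratum] (2.4), Thm. 1.1; [Castella2018] Thm. 3.1, §3 (arXiv:1704.06608 p. 9);
[SkinnerUrban2014] Thm. 3.29; [Skinner2016PacificMC] Thm. A; [FouquetWan2021] Thm. 4.41;
[BurungaleCastellaSkinner2025] Thm. 1.2.4, Thm. 3.2.1.
-/

set_option autoImplicit false
-- the summit's problem namespace `Summit.BirchSwinnertonDyer.BirchSwinnertonDyer` repeats a component by design (D-0017)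
set_option linter.dupNamespace false

noncomputable section

open scoped Classical NumberField

open WeierstrassCurve NumberField IsDedekindDomain Field PowerSeries
open Literature.NumberTheory.EllipticCurves Literature.NumberTheory.EllipticCurves.ModularForms
open Literature.NumberTheory.EllipticCurves.Rank1Residual
open Literature.NumberTheory.GaloisRepresentations
open Summit.BirchSwinnertonDyer.Rank1Residual Summit.BirchSwinnertonDyer.Rank1Residual.X11b
open Summit.BirchSwinnertonDyer.Rank1Residual.X11b.AcSelmer
open Summit.BirchSwinnertonDyer.Rank1Residual.X11b.Halves

namespace Summit.BirchSwinnertonDyer.BirchSwinnertonDyer.Theorems.OpenInputNotRamIMCDiv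

/-! ### §1 (2.4)∀ ∕ (2.4)∃♭ on the ¬(ram) pairs ⟹ the registered stub `stub_imcDivNotRam` -/

/-- **`stub_imcDivNotRam` ⟸ (2.4) for every `R₀`-frame on the ¬(ram) pairs.** The conclusion is the
registered stub signature of crux 19282 VERBATIM (the skeleton-local `InducesPrimeAt p ι' 𝔭` written
out as its body). Proof = datum plumbing: the stub's degree-one `𝔭` equals `𝔭_{ι'}` built from any
infinite place `w₀` (`eq_primeOfEmbeddingDatum_of_forall_mem_iff`); its newform `f` is `f_{Dt}`
(`IsNewformOf.unique`); the shape's auxiliary datum `(P', e)` is `(τ_* P, embAt K p 𝔭)` for the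
`τ ∈ Gal(K/ℚ)` with `w₀.embedding ∘ τ = ι` (as in multr1-p2's
`P2.openInputOnTreeAt_of_imcDivIntFrame_of_controlUpper`). CONDITIONAL on the open shape; nothing booked.
[cite: Castella2018Erratum, (2.4) (p. 4)] [cite: Castella2018, Thm. 3.1 (arXiv:1704.06608 p. 9)] -/
theorem stub_imcDivNotRam_of_imcDivAllUnrFrames
    (hA : ∀ (W : WeierstrassCurve ℚ) [W.IsElliptic] [W.IsGloballyMinimal] (p : ℕ) [Fact p.Prime],
      ¬ Ram W p → P2.IMCDivAllUnrFramesOnTree W p) :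
    ∀ (W : WeierstrassCurve ℚ) [W.IsElliptic] [W.IsGloballyMinimal] (p : ℕ) [Fact p.Prime]
      (N : ℕ) [NeZero N] (K : Type) [Field K] [NumberField K]
      (Dt : ModularParametrizationData W N) (H : HeegnerDatum N (NumberField.discr K)) (ι : K →+* ℂ)
      (P : (W.baseChange K).toAffine.Point),
      ¬ Literature.NumberTheory.EllipticCurves.Rank1Residual.Ram W p →
      ClassX11b W p → 5 ≤ p → Surj W p → W.conductorNorm ℤ = N → IsImaginaryQuadratic K →
      Odd (NumberField.discr K) → ¬ (p : ℤ) ∣ NumberField.discr K → ¬ p ∣ Units.torsionOrder K →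
      SatisfiesHeegnerHypothesis N K →
      (W.quadraticTwist (NumberField.discr K : ℚ)).entireLFunction 1 ≠ 0 →
      WeierstrassCurve.Affine.Point.map ι.toRatAlgHom P = heegnerPointComplex Dt H →
      ¬ (p : ℤ) ∣ Dt.c → ¬ IsOfFinAddOrder P →
      ∀ (κ : ZpExtension K p), κ.IsAnticyclotomic →
        ∀ (γ : Field.absoluteGaloisGroup K) [Fact (κ.IsTopGenerator γ)]
          (𝔭 : HeightOneSpectrum (𝓞 K)), ((p : ℕ) : 𝓞 K) ∈ 𝔭.asIdeal →
          𝔭.asIdeal.ramificationIdx (𝓞 ℚ) = 1 → 𝔭.asIdeal.inertiaDeg (𝓞 ℚ) = 1 →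
          ∀ (f : CuspForm (CongruenceSubgroup.Gamma0 N) 2), IsNewformOf W f →
            ∀ (ι' : PadicAlgCl p ≃+* ℂ),
              (∀ (w : InfinitePlace K) (k : 𝓞 K),
                k ∈ 𝔭.asIdeal ↔ ‖ι'.symm (w.embedding (k : K))‖ < 1) →
              ∀ (ΩK : ℂ) (Ωp : (unrIntegers p)ˣ) (L : UnrSeries p), ΩK ≠ 0 →
                IsBDPLFunction ι' 𝔭 κ γ f ΩK ((Ωp : unrIntegers p) : ℂ_[p]) L →
                  (XAc.charIdeal (W.baseChange K) p κ 𝔭 ∅ γ).map (PowerSeries.map (toUnr p)) ≤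
                    Ideal.span {L} := by
  intro W _ _ p _ N _ K _ _ Dt H ιK P hnr hX h5 hs hN hK hodd hpd hμ hHN hLt hP hc hPinf κ hκ γ _
    𝔭 h𝔭 he hf f hfW ι' hι' ΩK Ωp L hΩK hL
  -- an infinite place `w₀` (there is exactly one); the stub's `𝔭` is `𝔭_{ι'}`
  obtain ⟨w₀⟩ := (inferInstance : Nonempty (InfinitePlace K))
  have h𝔭eq : 𝔭 = primeOfEmbeddingDatum p ι' w₀.embedding :=
    eq_primeOfEmbeddingDatum_of_forall_mem_iff p ι' w₀.embedding (hι' w₀)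
  -- the stub's newform is the parametrisation datum's newform
  have hfeq : f = Dt.f := hfW.unique Dt.isNewformOf
  subst hfeq
  -- the datum's complex embedding is `w₀.embedding ∘ τ` for some `τ ∈ Gal(K/ℚ)`
  haveI : IsGalois ℚ K := by
    haveI : Algebra.IsQuadraticExtension ℚ K := ⟨hK.1⟩
    infer_instance
  obtain ⟨σ, hσ⟩ := ComplexEmbedding.exists_comp_symm_eq_of_comp_eq (k := ℚ) w₀.embedding ιK
    (by ext x; simp)
  set τ : K →+* K := ((σ.symm : K ≃ₐ[ℚ] K) : K →+* K) with hτdef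
  -- the Galois conjugate `P' = τ_* P` is the Heegner point read through `w₀.embedding`
  set P' := WeierstrassCurve.Affine.Point.map τ.toRatAlgHom P with hP'def
  have hP' : WeierstrassCurve.Affine.Point.map w₀.embedding.toRatAlgHom P' =
      heegnerPointComplex Dt H := by
    rw [hP'def, WeierstrassCurve.Affine.Point.map_map]
    have hcomp : w₀.embedding.toRatAlgHom.comp τ.toRatAlgHom = ιK.toRatAlgHom := by
      apply AlgHom.ext
      intro x
      have := RingHom.congr_fun hσ x
      simpa [hτdef] using this
    rw [hcomp]
    exact hP
  -- THE embedding at `𝔭` induces `𝔭`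
  have hemb : ∀ k : 𝓞 K, k ∈ 𝔭.asIdeal ↔ ‖embAt K p 𝔭 h𝔭 he hf (k : K)‖ < 1 :=
    mem_asIdeal_iff_norm_embAt_lt_one 𝔭 h𝔭 he hf
  -- instantiate the shape at the datum `(ι', w₀, P', embAt)`; its `𝔭_{ι'}` is the stub's `𝔭`
  have key := hA W p hnr N K Dt H ιK P hX h5 hs hN hK hodd hpd hμ hHN hLt hP hc hPinf κ hκ γ ι' w₀ P'
    hP' (embAt K p 𝔭 h𝔭 he hf)
  rw [← h𝔭eq] at key
  exact key hemb ΩK Ωp L hΩK hL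

/-- **`stub_imcDivNotRam` ⟸ (2.4)∃♭ on the ¬(ram) pairs** — the cell's value-free residual of crux 19282
(bdp g12's `hOffD`): (2.4)∃♭ ⟹ (2.4)∀ on every pair is multr1-p2's UNCONDITIONAL
`P2.imcDivAllUnrFramesOnTree_of_imcDivSomeFrame` (ideal rigidity across periods + descent along
`R₀⟦T⟧ → 𝓞_{ℂ_p}⟦T⟧`), then §1. So ANY road landing (2.4)∃♭ on the ¬(ram) pairs closes the deciding
stub of 19282's registered skeleton, with no further input. CONDITIONAL on (2.4)∃♭; nothing booked.
[cite: Castella2018Erratum, (2.4) (p. 4)] [cite: Castella2018, Thm. 3.1 and §3 (arXiv:1704.06608 p. 9)] -/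
theorem stub_imcDivNotRam_of_imcDivSomeFrame
    (hD : ∀ (W : WeierstrassCurve ℚ) [W.IsElliptic] [W.IsGloballyMinimal] (p : ℕ) [Fact p.Prime],
      ¬ Ram W p → P2.IMCDivSomeFrameOnTree W p) :
    ∀ (W : WeierstrassCurve ℚ) [W.IsElliptic] [W.IsGloballyMinimal] (p : ℕ) [Fact p.Prime]
      (N : ℕ) [NeZero N] (K : Type) [Field K] [NumberField K]
      (Dt : ModularParametrizationData W N) (H : HeegnerDatum N (NumberField.discr K)) (ι : K →+* ℂ)
      (P : (W.baseChange K).toAffine.Point),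
      ¬ Literature.NumberTheory.EllipticCurves.Rank1Residual.Ram W p →
      ClassX11b W p → 5 ≤ p → Surj W p → W.conductorNorm ℤ = N → IsImaginaryQuadratic K →
      Odd (NumberField.discr K) → ¬ (p : ℤ) ∣ NumberField.discr K → ¬ p ∣ Units.torsionOrder K →
      SatisfiesHeegnerHypothesis N K →
      (W.quadraticTwist (NumberField.discr K : ℚ)).entireLFunction 1 ≠ 0 →
      WeierstrassCurve.Affine.Point.map ι.toRatAlgHom P = heegnerPointComplex Dt H →
      ¬ (p : ℤ) ∣ Dt.c → ¬ IsOfFinAddOrder P →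
      ∀ (κ : ZpExtension K p), κ.IsAnticyclotomic →
        ∀ (γ : Field.absoluteGaloisGroup K) [Fact (κ.IsTopGenerator γ)]
          (𝔭 : HeightOneSpectrum (𝓞 K)), ((p : ℕ) : 𝓞 K) ∈ 𝔭.asIdeal →
          𝔭.asIdeal.ramificationIdx (𝓞 ℚ) = 1 → 𝔭.asIdeal.inertiaDeg (𝓞 ℚ) = 1 →
          ∀ (f : CuspForm (CongruenceSubgroup.Gamma0 N) 2), IsNewformOf W f →
            ∀ (ι' : PadicAlgCl p ≃+* ℂ),
              (∀ (w : InfinitePlace K) (k : 𝓞 K),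
                k ∈ 𝔭.asIdeal ↔ ‖ι'.symm (w.embedding (k : K))‖ < 1) →
              ∀ (ΩK : ℂ) (Ωp : (unrIntegers p)ˣ) (L : UnrSeries p), ΩK ≠ 0 →
                IsBDPLFunction ι' 𝔭 κ γ f ΩK ((Ωp : unrIntegers p) : ℂ_[p]) L →
                  (XAc.charIdeal (W.baseChange K) p κ 𝔭 ∅ γ).map (PowerSeries.map (toUnr p)) ≤
                    Ideal.span {L} :=
  stub_imcDivNotRam_of_imcDivAllUnrFrames fun W _ _ p _ hnr ↦
    P2.imcDivAllUnrFramesOnTree_of_imcDivSomeFrame (hD W p hnr)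

/-! ### §2 Conversely: the registered stub ⟹ (2.4)∀ on the ¬(ram) pairs; the equivalence -/

/-- **`stub_imcDivNotRam` ⟹ (2.4) for every `R₀`-frame on the ¬(ram) pairs.** Pure plumbing: at a
datum `(ι', w₀, P', e)` of the shape, the prime `𝔭_{ι'}` lies above `p`
(`natCast_mem_primeOfEmbeddingDatum`) and has degree one because `p ∣ N_E` (`Mult W p`) splits in the
strict-Heegner field `K` (`degreeOne_primeOfEmbeddingDatum`); `ι'` induces `𝔭_{ι'}` at EVERY infinite
place (`forall_mem_primeOfEmbeddingDatum_iff`, `K` imaginary quadratic); `f_{Dt}` is a newform of `W`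
(`Dt.isNewformOf`). CONDITIONAL on the stub; nothing booked.
[cite: Castella2018Erratum, (2.4) (p. 4)] [cite: Castella2018, Thm. 3.1 (arXiv:1704.06608 p. 9)] -/
theorem imcDivAllUnrFramesOnTree_of_stub_imcDivNotRam
    (h3 : ∀ (W : WeierstrassCurve ℚ) [W.IsElliptic] [W.IsGloballyMinimal] (p : ℕ) [Fact p.Prime]
      (N : ℕ) [NeZero N] (K : Type) [Field K] [NumberField K]
      (Dt : ModularParametrizationData W N) (H : HeegnerDatum N (NumberField.discr K)) (ι : K →+* ℂ)
      (P : (W.baseChange K).toAffine.Point),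
      ¬ Literature.NumberTheory.EllipticCurves.Rank1Residual.Ram W p →
      ClassX11b W p → 5 ≤ p → Surj W p → W.conductorNorm ℤ = N → IsImaginaryQuadratic K →
      Odd (NumberField.discr K) → ¬ (p : ℤ) ∣ NumberField.discr K → ¬ p ∣ Units.torsionOrder K →
      SatisfiesHeegnerHypothesis N K →
      (W.quadraticTwist (NumberField.discr K : ℚ)).entireLFunction 1 ≠ 0 →
      WeierstrassCurve.Affine.Point.map ι.toRatAlgHom P = heegnerPointComplex Dt H →
      ¬ (p : ℤ) ∣ Dt.c → ¬ IsOfFinAddOrder P →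
      ∀ (κ : ZpExtension K p), κ.IsAnticyclotomic →
        ∀ (γ : Field.absoluteGaloisGroup K) [Fact (κ.IsTopGenerator γ)]
          (𝔭 : HeightOneSpectrum (𝓞 K)), ((p : ℕ) : 𝓞 K) ∈ 𝔭.asIdeal →
          𝔭.asIdeal.ramificationIdx (𝓞 ℚ) = 1 → 𝔭.asIdeal.inertiaDeg (𝓞 ℚ) = 1 →
          ∀ (f : CuspForm (CongruenceSubgroup.Gamma0 N) 2), IsNewformOf W f →
            ∀ (ι' : PadicAlgCl p ≃+* ℂ),
              (∀ (w : InfinitePlace K) (k : 𝓞 K),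
                k ∈ 𝔭.asIdeal ↔ ‖ι'.symm (w.embedding (k : K))‖ < 1) →
              ∀ (ΩK : ℂ) (Ωp : (unrIntegers p)ˣ) (L : UnrSeries p), ΩK ≠ 0 →
                IsBDPLFunction ι' 𝔭 κ γ f ΩK ((Ωp : unrIntegers p) : ℂ_[p]) L →
                  (XAc.charIdeal (W.baseChange K) p κ 𝔭 ∅ γ).map (PowerSeries.map (toUnr p)) ≤
                    Ideal.span {L}) :
    ∀ (W : WeierstrassCurve ℚ) [W.IsElliptic] [W.IsGloballyMinimal] (p : ℕ) [Fact p.Prime],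
      ¬ Ram W p → P2.IMCDivAllUnrFramesOnTree W p := by
  intro W _ _ p _ hnr N _ K _ _ Dt H ιK P hX h5 hs hN hK hodd hpd hμ hHN hLt hP hc hPinf κ hκ γ _
    ι' w₀ P' _hP' e _he ΩK Ωp L hΩK hL
  -- `p ∣ N_E` splits in `K`, so `𝔭_{ι'}` has degree one
  have hsplit : SplitsIn K p := hHN p Fact.out (hN ▸ dvd_conductorNorm_of_mult hX.2.2.1)
  obtain ⟨he, hf⟩ := degreeOne_primeOfEmbeddingDatum p ι' hK.1 hsplit w₀.embedding
  exact h3 W p N K Dt H ιK P hnr hX h5 hs hN hK hodd hpd hμ hHN hLt hP hc hPinf κ hκ γ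
    (primeOfEmbeddingDatum p ι' w₀.embedding) (natCast_mem_primeOfEmbeddingDatum p ι' w₀.embedding)
    he hf Dt.f Dt.isNewformOf ι' (forall_mem_primeOfEmbeddingDatum_iff p ι' hK w₀) ΩK Ωp L hΩK hL

/-- **The registered deciding stub of crux 19282 and (2.4)∀ restricted to the ¬(ram) pairs are
EQUIVALENT** (kernel, no input). With multr1-p2's equivalences (`P2.imcDivSomeFrameOnTree_iff_…`,
given Hsieh 2014 Thm. 1 for the existence of a frame) all three currencies — the skeleton's H3, the
print-currency (2.4)∀ and the ♭-currency (2.4)∃♭ — agree on these pairs. [cite: Castella2018Erratum, (2.4) (p. 4)]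
[cite: Castella2018, Thm. 3.1 and §3 (arXiv:1704.06608 p. 9)] -/
theorem stub_imcDivNotRam_iff_imcDivAllUnrFrames :
    (∀ (W : WeierstrassCurve ℚ) [W.IsElliptic] [W.IsGloballyMinimal] (p : ℕ) [Fact p.Prime]
      (N : ℕ) [NeZero N] (K : Type) [Field K] [NumberField K]
      (Dt : ModularParametrizationData W N) (H : HeegnerDatum N (NumberField.discr K)) (ι : K →+* ℂ)
      (P : (W.baseChange K).toAffine.Point),
      ¬ Literature.NumberTheory.EllipticCurves.Rank1Residual.Ram W p →
      ClassX11b W p → 5 ≤ p → Surj W p → W.conductorNorm ℤ = N → IsImaginaryQuadratic K →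
      Odd (NumberField.discr K) → ¬ (p : ℤ) ∣ NumberField.discr K → ¬ p ∣ Units.torsionOrder K →
      SatisfiesHeegnerHypothesis N K →
      (W.quadraticTwist (NumberField.discr K : ℚ)).entireLFunction 1 ≠ 0 →
      WeierstrassCurve.Affine.Point.map ι.toRatAlgHom P = heegnerPointComplex Dt H →
      ¬ (p : ℤ) ∣ Dt.c → ¬ IsOfFinAddOrder P →
      ∀ (κ : ZpExtension K p), κ.IsAnticyclotomic →
        ∀ (γ : Field.absoluteGaloisGroup K) [Fact (κ.IsTopGenerator γ)]
          (𝔭 : HeightOneSpectrum (𝓞 K)), ((p : ℕ) : 𝓞 K) ∈ 𝔭.asIdeal →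
          𝔭.asIdeal.ramificationIdx (𝓞 ℚ) = 1 → 𝔭.asIdeal.inertiaDeg (𝓞 ℚ) = 1 →
          ∀ (f : CuspForm (CongruenceSubgroup.Gamma0 N) 2), IsNewformOf W f →
            ∀ (ι' : PadicAlgCl p ≃+* ℂ),
              (∀ (w : InfinitePlace K) (k : 𝓞 K),
                k ∈ 𝔭.asIdeal ↔ ‖ι'.symm (w.embedding (k : K))‖ < 1) →
              ∀ (ΩK : ℂ) (Ωp : (unrIntegers p)ˣ) (L : UnrSeries p), ΩK ≠ 0 →
                IsBDPLFunction ι' 𝔭 κ γ f ΩK ((Ωp : unrIntegers p) : ℂ_[p]) L →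
                  (XAc.charIdeal (W.baseChange K) p κ 𝔭 ∅ γ).map (PowerSeries.map (toUnr p)) ≤
                    Ideal.span {L}) ↔
    (∀ (W : WeierstrassCurve ℚ) [W.IsElliptic] [W.IsGloballyMinimal] (p : ℕ) [Fact p.Prime],
      ¬ Ram W p → P2.IMCDivAllUnrFramesOnTree W p) :=
  ⟨imcDivAllUnrFramesOnTree_of_stub_imcDivNotRam, stub_imcDivNotRam_of_imcDivAllUnrFrames⟩

/-! ### §3 The obstruction (O2), typed: at the stub's data the erratum road's hypothesis set is EMPTY -/

/-- **(O2) in the kernel — at a strict-Heegner field the hypotheses of the erratum's Thm. 1.1 are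
unsatisfiable.** `Thm11Hypotheses W p K` (multr1-p1's verbatim transcription of [Castella2018Erratum,
Thm. 1.1 (i)–(iv)], `X11b/CastellaErratum.lean`) contains the conjunct (iii)₂ «there is a prime
`q ∥ N` NON-SPLIT in `K` (at which `E[p]` is ramified)»; at the data of crux 19282 — and of every
classical datum of route p2 — the field satisfies `SatisfiesHeegnerHypothesis N_E K`, i.e. EVERY prime
of `N_E` splits in `K`, and every multiplicative prime divides `N_E` (`dvd_conductorNorm_of_mult`). So
no choice of auxiliary prime repairs the erratum ∕ Fouquet–Wan ∕ Wan 2020 road at these data: the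
definite quaternion datum those engines need does not exist over a strict-Heegner field (memo
`HOME/nram1/ROW4-MEMO.md` §1 (O2)). The same one-line argument kills [FouquetWan2021, Thm. 4.41]'s
third hypothesis and [Castella2018, Thm. 4.4]'s «at least one such prime». Bookkeeping; nothing booked.
[cite: Castella2018Erratum, Thm. 1.1 (iii) (p. 1)] [cite: Castella2018, Thm. 4.4 and §5 (arXiv:1704.06608 pp. 11–12)] -/
theorem not_thm11Hypotheses_of_satisfiesHeegnerHypothesis {W : WeierstrassCurve ℚ} [W.IsElliptic]
    [W.IsGloballyMinimal] {p : ℕ} [Fact p.Prime] {K : Type} [Field K] [NumberField K] {N : ℕ}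
    (hN : W.conductorNorm ℤ = N) (hHN : SatisfiesHeegnerHypothesis N K) :
    ¬ Thm11Hypotheses W p K := by
  rintro ⟨-, -, -, -, -, -, -, -, ⟨ℓ, hℓ, hmult, hns, -⟩, -⟩
  exact hns (hHN ℓ hℓ.out (hN ▸ dvd_conductorNorm_of_mult hmult))

end Summit.BirchSwinnertonDyer.BirchSwinnertonDyer.Theorems.OpenInputNotRamIMCDiv

end
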